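import Summits.ValiantsHypothesis.ValiantsHypothesis.Theorems.LacunarySymmetroidMatrixDescartesCensusLorentzRows

/-!
# `MatrixDescartes` census — kit lemmas for kernel replays of engine-3's BOX certificates (G3 rows, AM–GM rows, domination)

HONEST FRAMING.  Object-search cell `pub-symmetroid`, route crux `Theses.LacunarySymmetroid.MatrixDescartes`
(ledger item stmt-ValiantsHypothesis-18050).  Engine-3's box certificates (`HOME/pub-symmetroid-engine-3/box20/README-BOX20-e3g15.md`)
exclude `V = 20 = D(2,6)` on single 2-Sidon `(2,6)` supports using, besides F1 and the Newton-cone rows C25 (kernel: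
`…CensusFullAlternation`, `…CensusNewtonCone`, packaged per support by the `tnc_rows_*` lemmas), three further row types.
This file supplies their kernel forms once, so that per-support files only instantiate them:

* `g3_nonneg` — the Gram inequality «G3 ≥ 0»: for three real symmetric `2 × 2` letters with `qₗ = det Sₗ` and
  `βₗₘ = 2B(Sₗ,Sₘ)`, `4 q_i q_j q_k + β_ij β_jk β_ik − q_i β_jk² − q_j β_ik² − q_k β_ij² ≥ 0` (a square, tree
  `Census.gram_three_eq_sq`);
* the «single positive term» rows: if `a + b (+ c) (+ r) ≤ t` with non-negative terms then `a ≤ t`, `4ab ≤ t²` (AM–GM for two),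
  `27abc ≤ t³` (AM–GM for three) — `le_of_add_four_le`, `four_mul_le_sq_of_add_le`, `amgm_three_le_cube_of_add_le`;
* the root-extraction step of single-monomial DOMINATION: from `A·x^D ≤ B·y^D` (a Farkas product of rows) and a rational
  `u = un/ud` with `B·ud^D ≤ A·un^D` (decided in `ℕ`), `ud·x ≤ un·y` — `dom_root_le`.

Nothing here bears on `DoorA26` / `DoorA34` (OPEN, never asserted), on the crux `MatrixDescartes`, or on `VP ≠ VNP`.

[folklore] Elementary real inequalities.
-/

-- `Summit.ValiantsHypothesis.ValiantsHypothesis.…` repeats a component by the D-0017 layout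
-- (single-conjunct summit), which the `dupNamespace` linter flags; the name is mandated.
set_option linter.dupNamespace false

namespace Summit.ValiantsHypothesis.ValiantsHypothesis.Theorems.LacunarySymmetroidMatrixDescartes.Census

/-- **G3 ≥ 0.**  For three real symmetric `2 × 2` letters `[[a,b],[b,c]]`, `[[a',b'],[b',c']]`, `[[a'',b''],[b'',c'']]` with
`q = ac − b²` and `β = ac' + ca' − 2bb'` (twice the polar form of `det`): half the determinant of the `3 × 3` matrix
`[[2q, β, β'], …]` is a square, hence non-negative (engine-3's row family G3). [folklore] -/
theorem g3_nonneg (a b c a' b' c' a'' b'' c'' : ℝ) :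
    0 ≤ 4 * (a * c - b ^ 2) * (a' * c' - b' ^ 2) * (a'' * c'' - b'' ^ 2)
      + (a * c' + c * a' - 2 * (b * b')) * (a' * c'' + c' * a'' - 2 * (b' * b'')) *
          (a * c'' + c * a'' - 2 * (b * b''))
      - (a * c - b ^ 2) * (a' * c'' + c' * a'' - 2 * (b' * b'')) ^ 2
      - (a' * c' - b' ^ 2) * (a * c'' + c * a'' - 2 * (b * b'')) ^ 2
      - (a'' * c'' - b'' ^ 2) * (a * c' + c * a' - 2 * (b * b')) ^ 2 := by
  rw [gram_three_eq_sq]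
  positivity

/-- Single term of a «single positive term» row: `a + b + c + r ≤ t` with `b, c, r ≥ 0` gives `a ≤ t`. [folklore] -/
theorem le_of_add_four_le {a b c r t : ℝ} (hb : 0 ≤ b) (hc : 0 ≤ c) (hr : 0 ≤ r) (h : a + b + c + r ≤ t) :
    a ≤ t := by
  linarith

/-- AM–GM row for two terms: `a, b ≥ 0`, `a + b ≤ t` ⇒ `4ab ≤ t²`. [folklore] -/
theorem four_mul_le_sq_of_add_le {a b t : ℝ} (ha : 0 ≤ a) (hb : 0 ≤ b) (h : a + b ≤ t) :
    4 * a * b ≤ t ^ 2 := by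
  nlinarith [sq_nonneg (a - b), mul_nonneg ha hb]

/-- AM–GM row for three terms: `a, b, c ≥ 0`, `a + b + c ≤ t` ⇒ `27abc ≤ t³`. [folklore] -/
theorem amgm_three_le_cube_of_add_le {a b c t : ℝ} (ha : 0 ≤ a) (hb : 0 ≤ b) (hc : 0 ≤ c) (h : a + b + c ≤ t) :
    27 * a * b * c ≤ t ^ 3 := by
  have hs : 0 ≤ a + b + c := by positivity
  have h1 : 27 * a * b * c ≤ (a + b + c) ^ 3 := by
    nlinarith [mul_nonneg hs (sq_nonneg (a - b)), mul_nonneg hs (sq_nonneg (b - c)), mul_nonneg hs (sq_nonneg (a - c)),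
      mul_nonneg ha (sq_nonneg (b - c)), mul_nonneg hb (sq_nonneg (c - a)), mul_nonneg hc (sq_nonneg (a - b))]
  have h2 : (a + b + c) ^ 3 ≤ t ^ 3 := pow_le_pow_left₀ hs h 3
  linarith

/-- **Root extraction for a domination bound.**  From a Farkas product `A·x^D ≤ B·y^D` (`A > 0`, `x, y ≥ 0`, `D ≥ 1`)
and a rational `un/ud` with `B·ud^D ≤ A·un^D` (checked in `ℕ`): `ud·x ≤ un·y`. [folklore] -/
theorem dom_root_le {A B un ud D : ℕ} {x y : ℝ} (hD : D ≠ 0) (hA : 0 < A) (hx : 0 ≤ x) (hy : 0 ≤ y)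
    (h : (A : ℝ) * x ^ D ≤ (B : ℝ) * y ^ D) (hu : B * ud ^ D ≤ A * un ^ D) :
    (ud : ℝ) * x ≤ (un : ℝ) * y := by
  have hA' : (0 : ℝ) < (A : ℝ) := by exact_mod_cast hA
  have hu' : ((B : ℝ) * (ud : ℝ) ^ D) ≤ (A : ℝ) * (un : ℝ) ^ D := by exact_mod_cast hu
  have hyD : 0 ≤ y ^ D := pow_nonneg hy D
  have hudD : (0 : ℝ) ≤ (ud : ℝ) ^ D := pow_nonneg (Nat.cast_nonneg _) D
  have key : (A : ℝ) * ((ud : ℝ) * x) ^ D ≤ (A : ℝ) * ((un : ℝ) * y) ^ D := by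
    rw [mul_pow, mul_pow]
    calc (A : ℝ) * ((ud : ℝ) ^ D * x ^ D) = (ud : ℝ) ^ D * ((A : ℝ) * x ^ D) := by ring
      _ ≤ (ud : ℝ) ^ D * ((B : ℝ) * y ^ D) := mul_le_mul_of_nonneg_left h hudD
      _ = ((B : ℝ) * (ud : ℝ) ^ D) * y ^ D := by ring
      _ ≤ ((A : ℝ) * (un : ℝ) ^ D) * y ^ D := mul_le_mul_of_nonneg_right hu' hyD
      _ = (A : ℝ) * ((un : ℝ) ^ D * y ^ D) := by ring
  have key' : ((ud : ℝ) * x) ^ D ≤ ((un : ℝ) * y) ^ D := le_of_mul_le_mul_left key hA'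
  exact (pow_le_pow_iff_left₀ (by positivity) (by positivity) hD).1 key'

/-- Contradiction step of single-monomial DOMINATION with two competitors: if `t₀ ≤ t₁ + t₂` with `t₀ > 0`,
`L·tₖ ≤ nₖ·t₀` (`k = 1, 2`) and `n₁ + n₂ < L`, contradiction (generated files with more competitors call `linarith`
directly; this is the shape used most often). [folklore] -/
theorem dom_two_contra {t₀ t₁ t₂ : ℝ} {n₁ n₂ L : ℕ} (hL : n₁ + n₂ < L) (h0 : 0 < t₀) (hdom : t₀ ≤ t₁ + t₂)
    (h₁ : (L : ℝ) * t₁ ≤ (n₁ : ℝ) * t₀) (h₂ : (L : ℝ) * t₂ ≤ (n₂ : ℝ) * t₀) : False := by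
  have hL' : ((n₁ : ℝ) + (n₂ : ℝ)) < (L : ℝ) := by exact_mod_cast hL
  nlinarith

end Summit.ValiantsHypothesis.ValiantsHypothesis.Theorems.LacunarySymmetroidMatrixDescartes.Census
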